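import Summits.Schanuel.Schanuel.Theorems.TateLocusGPCOne.Negative.TateLocusGPCOneCalibration

/-!
# `TateLocusGPCOne` (crux stmt-Schanuel-17406): each of the generators `2πi, q, P, Q, R` is
# load-bearing for the count `5` — negative-side support (standing disprover, cycle 1, file 2 of 3)

For the crux `5 ≤ trdeg_ℚ ℚ(2πi, τ, q, P(q), Q(q), R(q))` (`Im τ > 0`, `τ` non-quadratic): no
five of the six numbers suffice. At the algebraic non-quadratic witness `τ₀ = i·2^{1/4}`
(`TateLocusGPCOneCalibration.lean` / p143528) every 5-subset containing `τ₀` has `trdeg ≤ 4`, so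
the variants of the crux with `2πi`, `q`, `P`, `Q` or `R` deleted from the generator list are all
FALSE under the crux's own hypotheses:
`tateLocusGPCOne_false_without_gen_twoPiI` (the right claim for `ℚ(τ, q, P, Q, R)` is Nesterenko's
Conjecture 1.11, `4`), `…_gen_q`, `…_gen_P`, `…_gen_Q`, `…_gen_R`. (The sixth generator `τ` is
treated in `TateLocusGPCOneAlgebraicNome.lean`, at an algebraic nome.) Sorry-free, standard axioms.
Informative content for provers: on the fibre `τ ∈ ℚ̄` (degree `≥ 3`) the crux asserts that
`π, q, P, Q, R` are ALL algebraically independent — every one of them must carry weight.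
-/

noncomputable section

set_option linter.dupNamespace false

namespace Summit.Schanuel.Schanuel.Theorems.TateLocusGPCOne.Negative

open Complex IntermediateField Filter
open Literature.Barriers.Schanuel

/-! ### Each of the generators `2πi, q, P, Q, R` is load-bearing for the count `5`
(witness: the algebraic non-quadratic `τ₀ = i·2^{1/4}`; five generators, one algebraic) -/

section genDrop

/-- **Without `2πi` the count `5` is false** (the right claim for `ℚ(τ, q, P, Q, R)` is
Nesterenko's Conjecture 1.11, `4`): at `τ₀ = i·2^{1/4}`, `trdeg ℚ((Complex.mk 0 (Real.sqrt (Real.sqrt 2))), q, P, Q, R) ≤ 4`. -/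
theorem tateLocusGPCOne_false_without_gen_twoPiI :
    ¬ (∀ τ : ℂ, 0 < τ.im → (∀ b c : ℚ, τ ^ 2 + (b : ℂ) * τ + (c : ℂ) ≠ 0) →
      (5 : Cardinal) ≤ Algebra.trdeg ℚ ↥(adjoin ℚ
        ({τ, Complex.exp (2 * Real.pi * Complex.I * τ),
          1 - 24 * ∑' l : ℕ, (ArithmeticFunction.sigma 1 (l + 1) : ℂ) *
            Complex.exp (2 * Real.pi * Complex.I * τ) ^ (l + 1),
          1 + 240 * ∑' l : ℕ, (ArithmeticFunction.sigma 3 (l + 1) : ℂ) *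
            Complex.exp (2 * Real.pi * Complex.I * τ) ^ (l + 1),
          1 - 504 * ∑' l : ℕ, (ArithmeticFunction.sigma 5 (l + 1) : ℂ) *
            Complex.exp (2 * Real.pi * Complex.I * τ) ^ (l + 1)} : Set ℂ))) := by
  intro h
  have h5 := h (Complex.mk 0 (Real.sqrt (Real.sqrt 2))) tau0_im_pos (quartic_witness_nonQuadratic _ sqrt_sqrt_two_mul_self)
  have h54 : (5 : Cardinal) ≤ ((4 : ℕ) : Cardinal) := h5.trans (trdeg_adjoin_le_of_subset_range_union
    ![Complex.exp (2 * Real.pi * Complex.I * (Complex.mk 0 (Real.sqrt (Real.sqrt 2)))),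
      1 - 24 * ∑' l : ℕ, (ArithmeticFunction.sigma 1 (l + 1) : ℂ) *
        Complex.exp (2 * Real.pi * Complex.I * (Complex.mk 0 (Real.sqrt (Real.sqrt 2)))) ^ (l + 1),
      1 + 240 * ∑' l : ℕ, (ArithmeticFunction.sigma 3 (l + 1) : ℂ) *
        Complex.exp (2 * Real.pi * Complex.I * (Complex.mk 0 (Real.sqrt (Real.sqrt 2)))) ^ (l + 1),
      1 - 504 * ∑' l : ℕ, (ArithmeticFunction.sigma 5 (l + 1) : ℂ) *
        Complex.exp (2 * Real.pi * Complex.I * (Complex.mk 0 (Real.sqrt (Real.sqrt 2)))) ^ (l + 1)]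
    {(Complex.mk 0 (Real.sqrt (Real.sqrt 2)))} _
    (fun x hx => by
      rw [Set.mem_singleton_iff.mp hx]
      exact quartic_witness_isAlgebraic _ sqrt_sqrt_two_mul_self)
    (by
      intro x hx
      simp only [Set.mem_insert_iff, Set.mem_singleton_iff] at hx
      rcases hx with rfl | rfl | rfl | rfl | rfl
      · exact Or.inr rfl
      · exact Or.inl ⟨0, by simp⟩
      · exact Or.inl ⟨1, by simp⟩
      · exact Or.inl ⟨2, by simp⟩
      · exact Or.inl ⟨3, by simp⟩))
  norm_num at h54

/-- **Without `q` the count `5` is false**: at `τ₀`, `trdeg ℚ(2πi, (Complex.mk 0 (Real.sqrt (Real.sqrt 2))), P, Q, R) ≤ 4`. -/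
theorem tateLocusGPCOne_false_without_gen_q :
    ¬ (∀ τ : ℂ, 0 < τ.im → (∀ b c : ℚ, τ ^ 2 + (b : ℂ) * τ + (c : ℂ) ≠ 0) →
      (5 : Cardinal) ≤ Algebra.trdeg ℚ ↥(adjoin ℚ
        ({2 * (Real.pi : ℂ) * Complex.I, τ,
          1 - 24 * ∑' l : ℕ, (ArithmeticFunction.sigma 1 (l + 1) : ℂ) *
            Complex.exp (2 * Real.pi * Complex.I * τ) ^ (l + 1),
          1 + 240 * ∑' l : ℕ, (ArithmeticFunction.sigma 3 (l + 1) : ℂ) *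
            Complex.exp (2 * Real.pi * Complex.I * τ) ^ (l + 1),
          1 - 504 * ∑' l : ℕ, (ArithmeticFunction.sigma 5 (l + 1) : ℂ) *
            Complex.exp (2 * Real.pi * Complex.I * τ) ^ (l + 1)} : Set ℂ))) := by
  intro h
  have h5 := h (Complex.mk 0 (Real.sqrt (Real.sqrt 2))) tau0_im_pos (quartic_witness_nonQuadratic _ sqrt_sqrt_two_mul_self)
  have h54 : (5 : Cardinal) ≤ ((4 : ℕ) : Cardinal) := h5.trans (trdeg_adjoin_le_of_subset_range_union
    ![2 * (Real.pi : ℂ) * Complex.I,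
      1 - 24 * ∑' l : ℕ, (ArithmeticFunction.sigma 1 (l + 1) : ℂ) *
        Complex.exp (2 * Real.pi * Complex.I * (Complex.mk 0 (Real.sqrt (Real.sqrt 2)))) ^ (l + 1),
      1 + 240 * ∑' l : ℕ, (ArithmeticFunction.sigma 3 (l + 1) : ℂ) *
        Complex.exp (2 * Real.pi * Complex.I * (Complex.mk 0 (Real.sqrt (Real.sqrt 2)))) ^ (l + 1),
      1 - 504 * ∑' l : ℕ, (ArithmeticFunction.sigma 5 (l + 1) : ℂ) *
        Complex.exp (2 * Real.pi * Complex.I * (Complex.mk 0 (Real.sqrt (Real.sqrt 2)))) ^ (l + 1)]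
    {(Complex.mk 0 (Real.sqrt (Real.sqrt 2)))} _
    (fun x hx => by
      rw [Set.mem_singleton_iff.mp hx]
      exact quartic_witness_isAlgebraic _ sqrt_sqrt_two_mul_self)
    (by
      intro x hx
      simp only [Set.mem_insert_iff, Set.mem_singleton_iff] at hx
      rcases hx with rfl | rfl | rfl | rfl | rfl
      · exact Or.inl ⟨0, by simp⟩
      · exact Or.inr rfl
      · exact Or.inl ⟨1, by simp⟩
      · exact Or.inl ⟨2, by simp⟩
      · exact Or.inl ⟨3, by simp⟩))
  norm_num at h54

/-- **Without `P = E₂` the count `5` is false**: at `τ₀`, `trdeg ℚ(2πi, (Complex.mk 0 (Real.sqrt (Real.sqrt 2))), q, Q, R) ≤ 4`. -/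
theorem tateLocusGPCOne_false_without_gen_P :
    ¬ (∀ τ : ℂ, 0 < τ.im → (∀ b c : ℚ, τ ^ 2 + (b : ℂ) * τ + (c : ℂ) ≠ 0) →
      (5 : Cardinal) ≤ Algebra.trdeg ℚ ↥(adjoin ℚ
        ({2 * (Real.pi : ℂ) * Complex.I, τ, Complex.exp (2 * Real.pi * Complex.I * τ),
          1 + 240 * ∑' l : ℕ, (ArithmeticFunction.sigma 3 (l + 1) : ℂ) *
            Complex.exp (2 * Real.pi * Complex.I * τ) ^ (l + 1),
          1 - 504 * ∑' l : ℕ, (ArithmeticFunction.sigma 5 (l + 1) : ℂ) *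
            Complex.exp (2 * Real.pi * Complex.I * τ) ^ (l + 1)} : Set ℂ))) := by
  intro h
  have h5 := h (Complex.mk 0 (Real.sqrt (Real.sqrt 2))) tau0_im_pos (quartic_witness_nonQuadratic _ sqrt_sqrt_two_mul_self)
  have h54 : (5 : Cardinal) ≤ ((4 : ℕ) : Cardinal) := h5.trans (trdeg_adjoin_le_of_subset_range_union
    ![2 * (Real.pi : ℂ) * Complex.I, Complex.exp (2 * Real.pi * Complex.I * (Complex.mk 0 (Real.sqrt (Real.sqrt 2)))),
      1 + 240 * ∑' l : ℕ, (ArithmeticFunction.sigma 3 (l + 1) : ℂ) *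
        Complex.exp (2 * Real.pi * Complex.I * (Complex.mk 0 (Real.sqrt (Real.sqrt 2)))) ^ (l + 1),
      1 - 504 * ∑' l : ℕ, (ArithmeticFunction.sigma 5 (l + 1) : ℂ) *
        Complex.exp (2 * Real.pi * Complex.I * (Complex.mk 0 (Real.sqrt (Real.sqrt 2)))) ^ (l + 1)]
    {(Complex.mk 0 (Real.sqrt (Real.sqrt 2)))} _
    (fun x hx => by
      rw [Set.mem_singleton_iff.mp hx]
      exact quartic_witness_isAlgebraic _ sqrt_sqrt_two_mul_self)
    (by
      intro x hx
      simp only [Set.mem_insert_iff, Set.mem_singleton_iff] at hx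
      rcases hx with rfl | rfl | rfl | rfl | rfl
      · exact Or.inl ⟨0, by simp⟩
      · exact Or.inr rfl
      · exact Or.inl ⟨1, by simp⟩
      · exact Or.inl ⟨2, by simp⟩
      · exact Or.inl ⟨3, by simp⟩))
  norm_num at h54

/-- **Without `Q = E₄` the count `5` is false**: at `τ₀`, `trdeg ℚ(2πi, (Complex.mk 0 (Real.sqrt (Real.sqrt 2))), q, P, R) ≤ 4`. -/
theorem tateLocusGPCOne_false_without_gen_Q :
    ¬ (∀ τ : ℂ, 0 < τ.im → (∀ b c : ℚ, τ ^ 2 + (b : ℂ) * τ + (c : ℂ) ≠ 0) →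
      (5 : Cardinal) ≤ Algebra.trdeg ℚ ↥(adjoin ℚ
        ({2 * (Real.pi : ℂ) * Complex.I, τ, Complex.exp (2 * Real.pi * Complex.I * τ),
          1 - 24 * ∑' l : ℕ, (ArithmeticFunction.sigma 1 (l + 1) : ℂ) *
            Complex.exp (2 * Real.pi * Complex.I * τ) ^ (l + 1),
          1 - 504 * ∑' l : ℕ, (ArithmeticFunction.sigma 5 (l + 1) : ℂ) *
            Complex.exp (2 * Real.pi * Complex.I * τ) ^ (l + 1)} : Set ℂ))) := by
  intro h
  have h5 := h (Complex.mk 0 (Real.sqrt (Real.sqrt 2))) tau0_im_pos (quartic_witness_nonQuadratic _ sqrt_sqrt_two_mul_self)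
  have h54 : (5 : Cardinal) ≤ ((4 : ℕ) : Cardinal) := h5.trans (trdeg_adjoin_le_of_subset_range_union
    ![2 * (Real.pi : ℂ) * Complex.I, Complex.exp (2 * Real.pi * Complex.I * (Complex.mk 0 (Real.sqrt (Real.sqrt 2)))),
      1 - 24 * ∑' l : ℕ, (ArithmeticFunction.sigma 1 (l + 1) : ℂ) *
        Complex.exp (2 * Real.pi * Complex.I * (Complex.mk 0 (Real.sqrt (Real.sqrt 2)))) ^ (l + 1),
      1 - 504 * ∑' l : ℕ, (ArithmeticFunction.sigma 5 (l + 1) : ℂ) *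
        Complex.exp (2 * Real.pi * Complex.I * (Complex.mk 0 (Real.sqrt (Real.sqrt 2)))) ^ (l + 1)]
    {(Complex.mk 0 (Real.sqrt (Real.sqrt 2)))} _
    (fun x hx => by
      rw [Set.mem_singleton_iff.mp hx]
      exact quartic_witness_isAlgebraic _ sqrt_sqrt_two_mul_self)
    (by
      intro x hx
      simp only [Set.mem_insert_iff, Set.mem_singleton_iff] at hx
      rcases hx with rfl | rfl | rfl | rfl | rfl
      · exact Or.inl ⟨0, by simp⟩
      · exact Or.inr rfl
      · exact Or.inl ⟨1, by simp⟩
      · exact Or.inl ⟨2, by simp⟩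
      · exact Or.inl ⟨3, by simp⟩))
  norm_num at h54

/-- **Without `R = E₆` the count `5` is false**: at `τ₀`, `trdeg ℚ(2πi, (Complex.mk 0 (Real.sqrt (Real.sqrt 2))), q, P, Q) ≤ 4`. -/
theorem tateLocusGPCOne_false_without_gen_R :
    ¬ (∀ τ : ℂ, 0 < τ.im → (∀ b c : ℚ, τ ^ 2 + (b : ℂ) * τ + (c : ℂ) ≠ 0) →
      (5 : Cardinal) ≤ Algebra.trdeg ℚ ↥(adjoin ℚ
        ({2 * (Real.pi : ℂ) * Complex.I, τ, Complex.exp (2 * Real.pi * Complex.I * τ),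
          1 - 24 * ∑' l : ℕ, (ArithmeticFunction.sigma 1 (l + 1) : ℂ) *
            Complex.exp (2 * Real.pi * Complex.I * τ) ^ (l + 1),
          1 + 240 * ∑' l : ℕ, (ArithmeticFunction.sigma 3 (l + 1) : ℂ) *
            Complex.exp (2 * Real.pi * Complex.I * τ) ^ (l + 1)} : Set ℂ))) := by
  intro h
  have h5 := h (Complex.mk 0 (Real.sqrt (Real.sqrt 2))) tau0_im_pos (quartic_witness_nonQuadratic _ sqrt_sqrt_two_mul_self)
  have h54 : (5 : Cardinal) ≤ ((4 : ℕ) : Cardinal) := h5.trans (trdeg_adjoin_le_of_subset_range_union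
    ![2 * (Real.pi : ℂ) * Complex.I, Complex.exp (2 * Real.pi * Complex.I * (Complex.mk 0 (Real.sqrt (Real.sqrt 2)))),
      1 - 24 * ∑' l : ℕ, (ArithmeticFunction.sigma 1 (l + 1) : ℂ) *
        Complex.exp (2 * Real.pi * Complex.I * (Complex.mk 0 (Real.sqrt (Real.sqrt 2)))) ^ (l + 1),
      1 + 240 * ∑' l : ℕ, (ArithmeticFunction.sigma 3 (l + 1) : ℂ) *
        Complex.exp (2 * Real.pi * Complex.I * (Complex.mk 0 (Real.sqrt (Real.sqrt 2)))) ^ (l + 1)]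
    {(Complex.mk 0 (Real.sqrt (Real.sqrt 2)))} _
    (fun x hx => by
      rw [Set.mem_singleton_iff.mp hx]
      exact quartic_witness_isAlgebraic _ sqrt_sqrt_two_mul_self)
    (by
      intro x hx
      simp only [Set.mem_insert_iff, Set.mem_singleton_iff] at hx
      rcases hx with rfl | rfl | rfl | rfl | rfl
      · exact Or.inl ⟨0, by simp⟩
      · exact Or.inr rfl
      · exact Or.inl ⟨1, by simp⟩
      · exact Or.inl ⟨2, by simp⟩
      · exact Or.inl ⟨3, by simp⟩))
  norm_num at h54

end genDrop

end Summit.Schanuel.Schanuel.Theorems.TateLocusGPCOne.Negative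

end
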